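import Summits.BirchSwinnertonDyer.Rank1Residual.X11b.LocSurjFromLevels
import Literature.NumberTheory.EllipticCurves.CasselsTateLemma615
import HarnessLib

/-!
# X11b, route p2 — from the PROPAGATED finite-level Castella structure to the Kummer vocabulary:
# `H¹_{𝓛^{(k)}}(K, E[p^k]) ≤ H¹(G_T, E[p^k]) ∩ ker loc_𝔭` and the uniform-bound-to-finiteness step

HONEST FRAMING (cell `b2b-bsdres`, run/shared/lean/b2b/bsd-rank1-residual/, verbatim in every
file): the goal of the cell is to DELETE the COMBINATION-SHAPED residual classes of the
Birch–Swinnerton-Dyer formula for ALL analytic-rank `≤ 1` elliptic curves over `ℚ` — "full BSD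
formula for every rank `≤ 1` curve in class `C`" assembled STRICTLY from published theorems — so
that the rank-`≤ 1` remainder becomes exactly the CONSTRUCTION-SHAPED classes, which are TYPED
(missing-input `Prop`s), NOT attempted. This is not "finishing BSD". Sub-cell
`b2b-bsdres-multr1-p2` (X11b, route p2 = BDP + converse + Kolyvagin, the JSW17 Prop. 3.2.1 "≤"
half (d) `P2SelmerCardBoundAt`); a RESEARCH ROUTE; no claim beyond the stated class; X11b stays
CONSTRUCTION-SHAPED; nothing here changes a label; no named fact is minted (theorems only; no
`sorry`).

## What is here (glue between multr1-p1's limit layer and multr1-p2's finite-level bound)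

multr1-p1 (`AnticyclotomicLevelStructure`) realised Castella's Selmer group over `K`,
`Sel_𝔭^Σ(K, E[p^∞]) = selmerAcBase`, as the Selmer group of a Selmer structure on `E[p^∞]` and
PROPAGATED it to the finite module `E[p^k]` (`AcSelmer.acLevelStructure`, Howard Def. 2.1.1).
multr1-p2 bounds, at level `n = p^k`, the subgroup `kummerOutside W n T ⊓ ker res_𝔭` of
`H¹(K, E[n])` (Parts A/B: `BDPRouteStrictAtPlace`, `BDPRouteRelaxation`).  This file connects the
two:

* **`connectingClass_mem_kummerLocalConditionAt`**: at ANY `K`-field `E` (a completion `K_v`),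
  the connecting class `δ(Q)` of a point `Q ∈ E[p^∞](K̄)` with `p^k • Q` fixed by `Γ_E` lies in
  the local Kummer condition `𝓛_E = ker (H¹(Γ_E, E[p^k]) → H¹(Γ_E, E(K̄_E)))` — its image is the
  coboundary of the local point `pointsMap Q`.  Hence the PROPAGATED zero condition
  `ker (H¹(K_v, E[p^k]) → H¹(K_v, E[p^∞]))` is contained in `𝓛_v`
  (`ker_map_primaryInclusion_le_kummerLocalConditionAt`; Greenberg LNM 1716 §5 / JSW17 §3.3.1:
  "the image of the local torsion under the Kummer map").
* **`selmerGroup_acLevelStructure_le_kummerOutside`**: for every finite set of places `T`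
  containing the finite places `v ≠ 𝔭` with `v ∣ p` or `v ∈ Σ`,
  `H¹_{𝓛^{(k)}}(K, E[p^k]) ≤ kummerOutside W (p^k) T`; and
  **`localization_eq_zero_of_mem_selmerGroup_acLevelStructure`**: if `E[p^∞](K̄)^{Γ_{K_𝔭}} = 0`
  (e.g. `E(K_𝔭)[p] = 0`, the erratum's (iv)), its classes die at `𝔭`; together
  **`selmerGroup_acLevelStructure_le_inf`**.
* **`finite_and_natCard_le_of_forall_level`**: if `E[p^∞]^{Γ_K} = 0` and EVERY level Selmer
  group `H¹_{𝓛^{(k)}}(K, E[p^k])` is finite of order `≤ B`, then `H¹_{𝓛^{ac,Σ}}(K, E[p^∞])` is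
  finite of order `≤ B` (it is `p`-primary and `H¹_{𝓛^{ac,Σ}}[p^k]` is the image of level `k`);
  **`exists_finite_selmerAcBase_natCard_le`**: the same for `selmerAcBase` — the shape of (d)'s
  conclusion `∃ (_ : Finite Sel) …, Nat.card Sel ≤ …`.

References: [GreenbergLNM1716] §5, proof of Prop. 5.8; [JetchevSkinnerWan2017] Prop. 3.2.1 and
§3.3.1 (arXiv:1512.06894 pp. 10–11); [Howard2004HeegnerKolyvagin] Def. 2.1.1; [Castella2018]
Def. 2.2; [SilvermanAEC2009] VIII.§2, X.§4.
-/

noncomputable section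

open scoped Classical

open CategoryTheory NumberField IsDedekindDomain Field
open Literature.NumberTheory.EllipticCurves Literature.NumberTheory.EllipticCurves.GreenbergSelmer
open Literature.NumberTheory.GaloisRepresentations
open Literature.NumberTheory.GaloisRepresentations.DiscreteGaloisModule (SelmerStructure)
open scoped ContRepresentation

universe u

namespace Summit.BirchSwinnertonDyer.Rank1Residual.X11b.LevelKummer

open Summit.BirchSwinnertonDyer.Rank1Residual.X11b.LocBridge
open Summit.BirchSwinnertonDyer.Rank1Residual.X11b.Levels
open Summit.BirchSwinnertonDyer.Rank1Residual.X11b.AcSelmer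

/-! ## §1. The propagated zero condition lies in the local Kummer condition -/

section Local

variable {K : Type u} [Field K] (W : WeierstrassCurve K) (p k : ℕ) (E : Type u) [Field E]
  [Algebra K E]

/-- **`δ(Q) ∈ 𝓛_E`**: for `Q ∈ E[p^∞](K̄)` with `p^k • Q` fixed by `Γ_E`, the connecting class
`δ(Q) = [σ ↦ σQ − Q] ∈ H¹(Γ_E, E[p^k](K̄))` maps to the coboundary of the local point `pointsMap Q`
in `H¹(Γ_E, E(K̄_E))`, so it lies in the local Kummer condition
`𝓛_E = ker (H¹(Γ_E, E[p^k]) → H¹(Γ_E, E(K̄_E)))`.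
[cite: GreenbergLNM1716, §5 proof of Prop. 5.8] [cite: SilvermanAEC2009, X.§4 (Kummer sequence)] -/
theorem connectingClass_mem_kummerLocalConditionAt (Q : W.geomPrimaryTorsion p)
    (hQ : ∀ σ : absoluteGaloisGroup E,
      GaloisRep.restrictField E (primaryGaloisModule W p) σ (p ^ k • Q) = p ^ k • Q) :
    connectingClass ((primaryInclusion W p k).restrictField E) (p ^ k)
        (exists_primaryInclusion_restrictField_eq_of_nsmul_eq_zero W p k E)
        (primaryInclusion_restrictField_injective W p k E) Q hQ ∈
      W.kummerLocalConditionAt ((p ^ k : ℕ) : ℤ) E := by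
  rw [WeierstrassCurve.mem_kummerLocalConditionAt_iff, connectingClass]
  rw [map_one_oneCocycleClass_eq_zero_iff]
  refine ⟨pointsMap W E (Q : W.geomPoints), fun σ ↦ ?_⟩
  have h0 := nsmul_cobCocycle_apply_eq_zero
      (ρB := GaloisRep.restrictField E (primaryGaloisModule W p)) (p ^ k) hQ
  -- `i (ψ̃ σ) = σQ − Q`, read in `E(K̄)`
  have h := congrArg (fun x : W.geomPrimaryTorsion p ↦ (x : W.geomPoints))
    (apply_liftCocycle (i := (primaryInclusion W p k).restrictField E) (n := p ^ k)
    (hrange := exists_primaryInclusion_restrictField_eq_of_nsmul_eq_zero W p k E)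
    (primaryInclusion_restrictField_injective W p k E)
    (cobCocycle (ρB := GaloisRep.restrictField E (primaryGaloisModule W p)) Q) h0 σ)
  rw [ContIntertwiningMap.restrictField_apply, coe_primaryInclusion_apply,
    Levels.cobCocycle_apply, AddSubgroupClass.coe_sub, GaloisRep.restrictField_apply] at h
  rw [WeierstrassCurve.torsionPointsMapIntertwining_apply, h, map_sub,
    WeierstrassCurve.localGaloisModule_apply_apply, ← pointsMap_smul W E σ (Q : W.geomPoints)]
  rfl

/-- **The propagated zero condition is contained in the local Kummer condition**:
`ker (H¹(Γ_E, E[p^k]) → H¹(Γ_E, E[p^∞])) ≤ 𝓛_E`.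
[cite: GreenbergLNM1716, §5 proof of Prop. 5.8]
[cite: JetchevSkinnerWan2017, §3.3.1 (arXiv:1512.06894 p. 11)] -/
theorem ker_map_primaryInclusion_le_kummerLocalConditionAt :
    (galoisCohomology.map ((primaryInclusion W p k).restrictField E) 1).ker ≤
      W.kummerLocalConditionAt ((p ^ k : ℕ) : ℤ) E := by
  intro c hc
  obtain ⟨Q, hQ, rfl⟩ :=
    (map_primaryInclusion_restrictField_eq_zero_iff W p k E c).mp ((AddMonoidHom.mem_ker).mp hc)
  exact connectingClass_mem_kummerLocalConditionAt W p k E Q hQ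

end Local

/-! ## §2. `H¹_{𝓛^{(k)}}(K, E[p^k]) ≤ kummerOutside W (p^k) T ⊓ ker loc_𝔭` -/

section Global

variable {K : Type u} [Field K] [NumberField K] (W : WeierstrassCurve K) (p k : ℕ)
  (𝔭 : HeightOneSpectrum (𝓞 K)) (S : Set (HeightOneSpectrum (𝓞 K)))

/-- At a place where Castella's structure is `0`, the localisation of a class of
`H¹_{𝓛^{(k)}}(K, E[p^k])` lies in the local Kummer condition.
[cite: Castella2018, Def. 2.2 (arXiv:1704.06608 p. 5)] [cite: GreenbergLNM1716, §5 proof of Prop. 5.8] -/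
theorem localization_mem_kummerLocalConditionAt_of_eq_bot {v : Place K}
    (hv : acStructure (primaryGaloisModule W p) p 𝔭 S v = ⊥)
    {c : galoisCohomology (W.torsionGaloisModule ((p ^ k : ℕ) : ℤ)) 1}
    (hc : c ∈ (acLevelStructure W p k 𝔭 S).selmerGroup) :
    galoisCohomology.localization (W.torsionGaloisModule ((p ^ k : ℕ) : ℤ)) v 1 c ∈
      W.kummerLocalConditionAt ((p ^ k : ℕ) : ℤ) (Place.Completion v) := by
  have h := (DiscreteGaloisModule.SelmerStructure.mem_selmerGroup_iff _ c).mp hc v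
  rw [acLevelStructure_eq_ker_of W p k 𝔭 S hv] at h
  exact ker_map_primaryInclusion_le_kummerLocalConditionAt W p k (Place.Completion v) h

/-- **`H¹_{𝓛^{(k)}}(K, E[p^k]) ≤ kummerOutside W (p^k) T`** for every finite set of places `T`
containing the finite places `v ≠ 𝔭` above `p` and the finite places `v ≠ 𝔭` of `Σ` (the places
where Castella's structure imposes no condition): at every other place the structure is `0`, and
the propagated zero condition lies in the local Kummer condition.
[cite: Castella2018, Def. 2.2 (arXiv:1704.06608 p. 5)]
[cite: JetchevSkinnerWan2017, Prop. 3.2.1 proof (arXiv:1512.06894 p. 10)] -/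
theorem selmerGroup_acLevelStructure_le_kummerOutside (T : Finset (Place K))
    (hT : ∀ v : HeightOneSpectrum (𝓞 K), v ≠ 𝔭 →
      (((p : ℕ) : 𝓞 K) ∈ v.asIdeal ∨ v ∈ S) → (Sum.inr v : Place K) ∈ T) :
    (acLevelStructure W p k 𝔭 S).selmerGroup ≤ kummerOutside W (p ^ k) T := by
  intro c hc
  rw [mem_kummerOutside_iff]
  intro v hvT
  refine localization_mem_kummerLocalConditionAt_of_eq_bot W p k 𝔭 S ?_ hc
  rcases v with w | v
  · exact acStructure_inl _ p 𝔭 S w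
  · rw [acStructure_inr]
    refine if_pos ?_
    by_cases hv𝔭 : v = 𝔭
    · exact Or.inl hv𝔭
    · right
      by_contra hcon
      refine hvT (hT v hv𝔭 ?_)
      by_cases hpv : ((p : ℕ) : 𝓞 K) ∈ v.asIdeal
      · exact Or.inl hpv
      · exact Or.inr (by_contra fun hvS ↦ hcon ⟨hpv, hvS⟩)

/-- **Classes of `H¹_{𝓛^{(k)}}(K, E[p^k])` die at `𝔭` when `E[p^∞](K̄)^{Γ_{K_𝔭}} = 0`** (e.g.
`E(K_𝔭)[p] = 0`, the erratum's (iv)): the condition at `𝔭` is the kernel of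
`H¹(K_𝔭, E[p^k]) → H¹(K_𝔭, E[p^∞])`, injective under the hypothesis.
[cite: Castella2018, Def. 2.2 (arXiv:1704.06608 p. 5)] [cite: GreenbergLNM1716, §2 p. 63] -/
theorem localization_eq_zero_of_mem_selmerGroup_acLevelStructure
    (hΓ : ∀ Q : W.geomPrimaryTorsion p,
      (∀ σ : absoluteGaloisGroup (Place.Completion (Sum.inr 𝔭 : Place K)),
        GaloisRep.restrictField (Place.Completion (Sum.inr 𝔭 : Place K)) (primaryGaloisModule W p)
          σ Q = Q) → Q = 0)
    {c : galoisCohomology (W.torsionGaloisModule ((p ^ k : ℕ) : ℤ)) 1}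
    (hc : c ∈ (acLevelStructure W p k 𝔭 S).selmerGroup) :
    galoisCohomology.localization (W.torsionGaloisModule ((p ^ k : ℕ) : ℤ)) (Sum.inr 𝔭) 1 c = 0 := by
  have h := (DiscreteGaloisModule.SelmerStructure.mem_selmerGroup_iff _ c).mp hc (Sum.inr 𝔭)
  rw [acLevelStructure_eq_ker_of W p k 𝔭 S (acStructure_self _ p 𝔭 S)] at h
  replace h : galoisCohomology.map
      ((primaryInclusion W p k).restrictField (Place.Completion (Sum.inr 𝔭 : Place K))) 1
      (galoisCohomology.localization (W.torsionGaloisModule ((p ^ k : ℕ) : ℤ)) (Sum.inr 𝔭) 1 c) =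
        0 := h
  exact map_primaryInclusion_restrictField_injective W p k _ hΓ (h.trans (map_zero _).symm)

/-- **`H¹_{𝓛^{(k)}}(K, E[p^k]) ≤ kummerOutside W (p^k) T ⊓ ker loc_𝔭`** — the finite-level object
bounded by route p2's Parts A/B (`BDPRouteStrictAtPlace`, `BDPRouteRelaxation`).
[cite: JetchevSkinnerWan2017, Prop. 3.2.1 proof (arXiv:1512.06894 p. 10)]
[cite: Castella2018, Def. 2.2 (arXiv:1704.06608 p. 5)] -/
theorem selmerGroup_acLevelStructure_le_inf (T : Finset (Place K))
    (hT : ∀ v : HeightOneSpectrum (𝓞 K), v ≠ 𝔭 →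
      (((p : ℕ) : 𝓞 K) ∈ v.asIdeal ∨ v ∈ S) → (Sum.inr v : Place K) ∈ T)
    (hΓ : ∀ Q : W.geomPrimaryTorsion p,
      (∀ σ : absoluteGaloisGroup (Place.Completion (Sum.inr 𝔭 : Place K)),
        GaloisRep.restrictField (Place.Completion (Sum.inr 𝔭 : Place K)) (primaryGaloisModule W p)
          σ Q = Q) → Q = 0) :
    (acLevelStructure W p k 𝔭 S).selmerGroup ≤
      kummerOutside W (p ^ k) T ⊓
        (galoisCohomology.localization (W.torsionGaloisModule ((p ^ k : ℕ) : ℤ)) (Sum.inr 𝔭) 1).ker :=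
  fun _ hc ↦ ⟨selmerGroup_acLevelStructure_le_kummerOutside W p k 𝔭 S T hT hc,
    (AddMonoidHom.mem_ker).mpr
      (localization_eq_zero_of_mem_selmerGroup_acLevelStructure W p k 𝔭 S hΓ hc)⟩

/-- Cardinality form: with `T`, (iv)-type hypothesis at `𝔭` as above and the target finite,
`#H¹_{𝓛^{(k)}}(K, E[p^k]) ≤ #(kummerOutside W (p^k) T ⊓ ker loc_𝔭)` and the level group is finite.
[cite: JetchevSkinnerWan2017, Prop. 3.2.1 proof (arXiv:1512.06894 p. 10)] -/
theorem finite_and_natCard_selmerGroup_acLevelStructure_le (T : Finset (Place K))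
    (hT : ∀ v : HeightOneSpectrum (𝓞 K), v ≠ 𝔭 →
      (((p : ℕ) : 𝓞 K) ∈ v.asIdeal ∨ v ∈ S) → (Sum.inr v : Place K) ∈ T)
    (hΓ : ∀ Q : W.geomPrimaryTorsion p,
      (∀ σ : absoluteGaloisGroup (Place.Completion (Sum.inr 𝔭 : Place K)),
        GaloisRep.restrictField (Place.Completion (Sum.inr 𝔭 : Place K)) (primaryGaloisModule W p)
          σ Q = Q) → Q = 0)
    [Finite ↥(kummerOutside W (p ^ k) T ⊓
        (galoisCohomology.localization (W.torsionGaloisModule ((p ^ k : ℕ) : ℤ)) (Sum.inr 𝔭) 1).ker)] :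
    Finite (acLevelStructure W p k 𝔭 S).selmerGroup ∧
      Nat.card (acLevelStructure W p k 𝔭 S).selmerGroup ≤
        Nat.card ↥(kummerOutside W (p ^ k) T ⊓
          (galoisCohomology.localization (W.torsionGaloisModule ((p ^ k : ℕ) : ℤ)) (Sum.inr 𝔭) 1).ker) :=
  have hle := selmerGroup_acLevelStructure_le_inf W p k 𝔭 S T hT hΓ
  ⟨Finite.of_injective _ (AddSubgroup.inclusion_injective hle), AddSubgroup.card_le_of_le hle⟩

end Global

/-! ## §3. From a uniform bound at all levels to finiteness of `Sel_𝔭^Σ(K, E[p^∞])` -/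

section Limit

variable {K : Type u} [Field K] [NumberField K] (W : WeierstrassCurve K) (p : ℕ) [Fact p.Prime]
  (𝔭 : HeightOneSpectrum (𝓞 K)) (S : Set (HeightOneSpectrum (𝓞 K)))

omit [NumberField K] [Fact p.Prime] in
/-- Every class of `H¹(K, E[p^∞])` is killed by a power of `p`. [folklore] -/
private theorem exists_pow_nsmul_eq_zero_primary
    (x : galoisCohomology (primaryGaloisModule W p) 1) : ∃ N : ℕ, p ^ N • x = 0 :=
  exists_pow_nsmul_eq_zero_of_primary _
    (fun Q ↦ AddCommGroup.mem_primaryComponent.mp Q.2 |>.imp fun k hk ↦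
      Subtype.ext (by rw [AddSubmonoidClass.coe_nsmul, hk, ZeroMemClass.coe_zero])) x

omit [NumberField K] [Fact p.Prime] in
/-- A finite family of classes of `H¹(K, E[p^∞])` has a common killing exponent. [folklore] -/
private theorem exists_pow_nsmul_finset_eq_zero
    (F : Finset (galoisCohomology (primaryGaloisModule W p) 1)) :
    ∃ N : ℕ, ∀ x ∈ F, p ^ N • x = 0 := by
  classical
  choose k hk using fun x : galoisCohomology (primaryGaloisModule W p) 1 ↦
    exists_pow_nsmul_eq_zero_primary W p x
  refine ⟨F.sum k, fun x hx ↦ ?_⟩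
  have hle : k x ≤ F.sum k := Finset.single_le_sum (fun _ _ ↦ Nat.zero_le _) hx
  rw [← pow_mul_pow_sub p hle, mul_comm, mul_smul, hk x, smul_zero]

/-- **Uniform level bounds give finiteness and the bound in the limit.** If `E[p^∞]^{Γ_K} = 0`,
`E(K̄)` is divisible, and every level Selmer group `H¹_{𝓛^{(k)}}(K, E[p^k])` is finite of order
`≤ B`, then `H¹_{𝓛^{ac,Σ}}(K, E[p^∞])` is finite of order `≤ B`: a finite subset is killed by one
`p^k`, hence lies in the image of level `k` (`AcSelmer.exists_map_eq_of_mem_of_nsmul_eq_zero`).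
[cite: GreenbergLNM1716, §5 proof of Prop. 5.8]
[cite: JetchevSkinnerWan2017, Prop. 3.2.1 (arXiv:1512.06894 p. 10)] -/
theorem finite_and_natCard_le_of_forall_level (hdiv : W.zsmul_geomPoints_surjective) [W.IsElliptic]
    (B : ℕ) (hfin : ∀ k, Finite (acLevelStructure W p k 𝔭 S).selmerGroup)
    (hB : ∀ k, Nat.card (acLevelStructure W p k 𝔭 S).selmerGroup ≤ B) :
    Finite ((acStructure (primaryGaloisModule W p) p 𝔭 S).selmerGroup) ∧
      Nat.card ((acStructure (primaryGaloisModule W p) p 𝔭 S).selmerGroup) ≤ B := by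
  classical
  set Sel := (acStructure (primaryGaloisModule W p) p 𝔭 S).selmerGroup with hSel
  -- every finite subset of `Sel` has at most `B` elements
  have key : ∀ F : Finset Sel, F.card ≤ B := by
    intro F
    obtain ⟨N, hN⟩ := exists_pow_nsmul_finset_eq_zero W p (F.image (fun x : Sel ↦ (x : _)))
    haveI := hfin N
    -- each element of `F` lifts to level `N`
    have hlift : ∀ x ∈ F, ∃ c : (acLevelStructure W p N 𝔭 S).selmerGroup,
        galoisCohomology.map (primaryInclusion W p N) 1 (c : _) = (x : _) := by
      intro x hx
      obtain ⟨c, hc, hcx⟩ := exists_map_eq_of_mem_of_nsmul_eq_zero W p N 𝔭 S hdiv x.2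
        (hN _ (Finset.mem_image_of_mem _ hx))
      exact ⟨⟨c, hc⟩, hcx⟩
    choose! g hg using hlift
    -- `g` is injective on `F`
    have hinj : Set.InjOn g F := by
      intro x hx y hy hxy
      apply Subtype.ext
      rw [← hg x hx, ← hg y hy, hxy]
    calc F.card = (F.image g).card := (Finset.card_image_of_injOn hinj).symm
      _ ≤ Nat.card (acLevelStructure W p N 𝔭 S).selmerGroup := by
          haveI := Fintype.ofFinite (acLevelStructure W p N 𝔭 S).selmerGroup
          rw [Nat.card_eq_fintype_card]
          exact Finset.card_le_univ _
      _ ≤ B := hB N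
  -- hence `Sel` is finite …
  have hfinite : Finite Sel := by
    by_contra hinf
    rw [not_finite_iff_infinite] at hinf
    obtain ⟨F, hF⟩ := Infinite.exists_subset_card_eq Sel (B + 1)
    have := key F
    omega
  refine ⟨hfinite, ?_⟩
  -- … of order `≤ B`
  haveI := Fintype.ofFinite Sel
  rw [Nat.card_eq_fintype_card, ← Finset.card_univ]
  exact key _

/-- **Route R1/p2's object**: under the same hypotheses, `Sel_𝔭^Σ(K, E[p^∞]) = selmerAcBase W p 𝔭 Σ`
is finite of order `≤ B` — the shape `∃ (_ : Finite Sel), … Nat.card Sel ≤ …` of (d)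
`P2SelmerCardBoundAt`'s conclusion. [cite: Castella2018, Def. 2.2 and Thm. 2.3 (arXiv:1704.06608 p. 5)]
[cite: JetchevSkinnerWan2017, Prop. 3.2.1 (arXiv:1512.06894 p. 10)] -/
theorem exists_finite_selmerAcBase_natCard_le (hdiv : W.zsmul_geomPoints_surjective) [W.IsElliptic]
    (B : ℕ) (hfin : ∀ k, Finite (acLevelStructure W p k 𝔭 S).selmerGroup)
    (hB : ∀ k, Nat.card (acLevelStructure W p k 𝔭 S).selmerGroup ≤ B) :
    ∃ _ : Finite (selmerAcBase W p 𝔭 S), Nat.card (selmerAcBase W p 𝔭 S) ≤ B := by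
  obtain ⟨hF, hle⟩ := finite_and_natCard_le_of_forall_level W p 𝔭 S hdiv B hfin hB
  refine ⟨?_, ?_⟩
  · haveI := hF
    rw [selmerAcBase_eq_map_selmerGroup]
    exact Finite.of_surjective
      (fun x : (acStructure (primaryGaloisModule W p) p 𝔭 S).selmerGroup ↦
        (⟨(topEquivH1 (isOpen_stabilizer_geomPrimaryTorsion W p)).toAddMonoidHom x.1,
          ⟨x.1, x.2, rfl⟩⟩ : ((acStructure (primaryGaloisModule W p) p 𝔭 S).selmerGroup).map
            (topEquivH1 (isOpen_stabilizer_geomPrimaryTorsion W p)).toAddMonoidHom))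
      (by rintro ⟨_, x, hx, rfl⟩; exact ⟨⟨x, hx⟩, rfl⟩)
  · rw [natCard_selmerAcBase_eq_natCard_selmerGroup]
    exact hle

end Limit

end Summit.BirchSwinnertonDyer.Rank1Residual.X11b.LevelKummer

end
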